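/-
Copyright (c) 2026. All rights reserved.
Released under Apache 2.0 license as described in the file LICENSE.
Authors: abc-iut cell — seat abc-iut-w5-d053 (gen 3; (G) of abc-iut-L4-t5's row «Cor36-CROSS», offered 08:51Z /
started 09:09Z unrefused; L4-lead row «Cor36-K-STEP3» lineage).
-/
import Literature.AnabelianGeometry.AbsoluteAnabelian.AbsTopIII.FrobeniusPictureMLFLogGlueFamily

/-!
# [AbsTopIII] Cor 3.6 (iii): the cross-term GENERATOR identity from `IotaOverGaloisStmt`

S. Mochizuki, *Topics in Absolute Anabelian Geometry III*, Cor. 3.6 (iii) pp. 80–81, Def. 3.5 (ii) p. 75,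
Rmk. 3.5.1 p. 78 (`MochizukiAbsTopIII2015`).  PROOF-ONLY file (no definition).

The chain `FrobeniusPictureMLFLogGlueFamilyEta` (p430476) → `…LogGlueFamily` (p431675) → `…LogGlueCrossAdapter`
(p432316) → `…LogGlueCrossInduction` (p433228) reduces the cores clause of Cor. 3.6 (iii),
`LogObsCompatCoresStmt`, to the identity `hbase` for the GENERATOR pairs of `E_log` (types (1)/(2): the basic
pairs `([λ^×]∘[id_⋎]∘[log], [λ^{×pf}]∘[id_{⋎+1}])`, `([λ^×], [λ^{×pf}])`), pre-whiskered by `embLog[r]` and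
post-whiskered by `r₂` into a core vertex.  THIS file proves that identity from the named fact
`IotaOverGaloisStmt` (F-0360 — "`ι_×`, `ι_{log}` lie over `ℰ`", PROVED AT THE MODEL by
`TFModel.iotaOverGaloisStmt_model`) for every log-observable family `H₃` (whose homotopies on the basic pairs ARE
`ι_×`, `ι_{log,⋎}`: `LogPinned`):

* §6 generic (`DiagramOfCategories.OverData`): `lift_cons_eq_whiskerRight`, `lift_comp_cons_eq_whisker` — the
  lift over a fully faithful structure functor of a pair `([e]∘P∘R, [e]∘Q∘R)` IS `𝒟_R ◁ (θ ▷ 𝒟_e)` as soon as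
  `θ ▷ 𝒟_e` lies over the structure isomorphisms (uniqueness of lifts `lift_ext`, `lift_precomp_heq`);
* §7 `imageCross_of_over`: the generator-shaped identity for a pair into `𝒩` from «its whiskered `𝔖_log`
  homotopy lies over `ℰ`» (via `univFamily_η_eq` at the decomposition through `ℰ` and §6);
* §8–§10 the «lies over `ℰ`» computation for the basic pairs: `over_timesPair_inl` / `over_timesPair_inr`
  (type (2), both directions of `ι_×`) and `over_logPair` (type (1)), componentwise from `LogPinned` and
  `IotaOverGaloisStmt` — every morphism involved is an `eqToHom` (type (2)) or an `eqToHom`-conjugate of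
  `(𝒳→ℰ)(id_⋎(log ≅ 𝟭))` (type (1)); and the assembled
  **`generatorCross_of_iotaOverGalois (hH₃ : IsLogObservableFamily H₃) (hι : IotaOverGaloisStmt) : hbase`**.

So the cores clause of [AbsTopIII] Cor. 3.6 (iii) follows, for every `𝒟` satisfying `IotaOverGaloisStmt` and
every log-observable family, by the one-line composition `logObsCompatCoresStmt_of_imageCross hH₃ (fun _ _ r p q hh
_ r₂ hd h' => imageCross_of_generators hH₃ (generatorCross_of_iotaOverGalois hH₃ hι) ((hH₃.1 p q).mp hh) r hh r₂ hd
h')` (to be filed once p432316/p433228 are built; not in this file to keep it independent of pending oleans).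
HONEST SCOPE: conditional on the named fact `IotaOverGaloisStmt` (a hypothesis, discharged at the model elsewhere);
no claim of the paper is asserted beyond that; nothing bears on [IUTchIII] Cor. 3.12; typed ≠ discharged.
-/

namespace Literature.AnabelianGeometry.AbsoluteAnabelian

open _root_.CategoryTheory _root_.Quiver

universe u

/-! ### §6 (abc-iut-w5-d053): lifts over `ℰ` of whiskered 2-cells (generic), for the generator identity -/

namespace DiagramOfCategories.OverData

variable {V : Type*} [Quiver V] {D : DiagramOfCategories V} {C : Type*} [Category C] (O : D.OverData C)

/-- **The lift of a pair `([e]∘P, [e]∘Q)` into a vertex `w` with fully faithful structure functor IS the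
whiskered 2-cell `θ ▷ 𝒟_e`, as soon as `θ ▷ 𝒟_e` lies over the structure isomorphisms** (uniqueness of
lifts, `lift_ext`; Def. 3.5 (ii) across a fully faithful structure functor, Rmk. 3.5.1).
[cite: MochizukiAbsTopIII2015, Remark 3.5.1 p.78] -/
theorem lift_cons_eq_whiskerRight {b c w : V} (hw : (O.N w).FullyFaithful) (P Q : Path b c) (e : c ⟶ w)
    (θ : D.pathFunctor P ⟶ D.pathFunctor Q)
    (hθ : ∀ y : D.obj b, (O.N w).map ((D.map e).map (θ.app y)) =
      (O.μ e).hom.app ((D.pathFunctor P).obj y) ≫ (O.pathIso P).hom.app y ≫ (O.pathIso Q).inv.app y ≫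
        (O.μ e).inv.app ((D.pathFunctor Q).obj y))
    (h₁ : D.pathFunctor (P.cons e) = D.pathFunctor P ⋙ D.map e)
    (h₂ : D.pathFunctor Q ⋙ D.map e = D.pathFunctor (Q.cons e)) :
    O.lift hw (P.cons e) (Q.cons e) = eqToHom h₁ ≫ Functor.whiskerRight θ (D.map e) ≫ eqToHom h₂ := by
  refine (O.lift_ext hw _ fun y => ?_).symm
  have key : (O.N w).map ((eqToHom h₁ ≫ Functor.whiskerRight θ (D.map e) ≫ eqToHom h₂).app y) ≫
      (O.pathIso (Q.cons e)).hom.app y = (O.pathIso (P.cons e)).hom.app y := by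
    simp only [NatTrans.comp_app, eqToHom_app, Functor.whiskerRight_app, Functor.map_comp, eqToHom_map,
      pathIso_cons_app, Category.assoc]
    erw [hθ y]
    repeat erw [Category.assoc]
    erw [eqToHom_trans_assoc, eqToHom_refl, Category.id_comp, Iso.inv_hom_id_app_assoc,
      Iso.inv_hom_id_app, Category.comp_id]
    rfl
  erw [← key, Category.assoc, Iso.hom_inv_id_app, Category.comp_id]

/-- `eqToHom` bookkeeping: left whiskering of an `eqToHom`-sandwich (generic). [folklore] -/
private theorem whiskerLeft_eqToHom_sandwich {A B E : Type*} [Category A] [Category B] [Category E]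
    (F : A ⥤ B) {G G' H H' : B ⥤ E} (h₁ : G = G') (α : G' ⟶ H') (h₂ : H' = H) :
    Functor.whiskerLeft F (eqToHom h₁ ≫ α ≫ eqToHom h₂) =
      eqToHom (by rw [h₁]) ≫ Functor.whiskerLeft F α ≫ eqToHom (by rw [h₂]) := by
  subst h₁ h₂
  simp

/-- **Pre-whiskered form**: the lift of `([e]∘P∘R, [e]∘Q∘R)` is `𝒟_R ◁ (θ ▷ 𝒟_e)` (from
`lift_cons_eq_whiskerRight` and the pre-composition law of lifts `lift_precomp_heq`).
[cite: MochizukiAbsTopIII2015, Remark 3.5.1 p.78] -/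
theorem lift_comp_cons_eq_whisker {a b c w : V} (hw : (O.N w).FullyFaithful) (R : Path a b)
    (P Q : Path b c) (e : c ⟶ w) (θ : D.pathFunctor P ⟶ D.pathFunctor Q)
    (hθ : ∀ y : D.obj b, (O.N w).map ((D.map e).map (θ.app y)) =
      (O.μ e).hom.app ((D.pathFunctor P).obj y) ≫ (O.pathIso P).hom.app y ≫ (O.pathIso Q).inv.app y ≫
        (O.μ e).inv.app ((D.pathFunctor Q).obj y))
    (k₁ : D.pathFunctor ((R.comp P).cons e) = D.pathFunctor R ⋙ (D.pathFunctor P ⋙ D.map e))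
    (k₂ : D.pathFunctor R ⋙ (D.pathFunctor Q ⋙ D.map e) = D.pathFunctor ((R.comp Q).cons e)) :
    O.lift hw ((R.comp P).cons e) ((R.comp Q).cons e) =
      eqToHom k₁ ≫ Functor.whiskerLeft (D.pathFunctor R) (Functor.whiskerRight θ (D.map e)) ≫ eqToHom k₂ := by
  have h := O.lift_precomp_heq hw R (P.cons e) (Q.cons e)
  rw [O.lift_cons_eq_whiskerRight hw P Q e θ hθ (D.pathFunctor_cons P e) (D.pathFunctor_cons Q e).symm] at h
  exact (conj_eqToHom_iff_heq' _ _ k₁ k₂).mpr (h.trans ((heq_of_eq (whiskerLeft_eqToHom_sandwich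
    (D.pathFunctor R) (D.pathFunctor_cons P e) _ (D.pathFunctor_cons Q e).symm)).trans
    (DiagramOfCategories.HomotopyFamily.heq_eqToHom_comp_comp_eqToHom _ _ _)))

end DiagramOfCategories.OverData

namespace LogFrobeniusData

open DiagramOfCategories

variable (Δ : LogFrobeniusData.{u})

/-! ### §7 (abc-iut-w5-d053): the generator identity from «the whiskered 𝔖_log homotopy lies over ℰ» -/

/-- Generic: a right-whiskered sandwich of a left-whiskered right-whiskering, re-indexed (assembly step).
[folklore] -/
private theorem sandwich_whiskerRight_whiskerLeft {A B C C₁ C' : Type*} [Category A] [Category B]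
    [Category C] [Category C₁] [Category C'] {F : A ⥤ B} {G H : B ⥤ C} (θ : G ⟶ H) (J : C ⥤ C₁)
    (I : C₁ ⥤ C') {I' : C ⥤ C'} (hI : I' = J ⋙ I) {X₁ Y₁ : A ⥤ C₁} (k₁ : X₁ = F ⋙ (G ⋙ J))
    (k₂ : F ⋙ (H ⋙ J) = Y₁) {X Y : A ⥤ C'} (a : X = X₁ ⋙ I) (b : Y₁ ⋙ I = Y) (eX : X = F ⋙ (G ⋙ I'))
    (eY : F ⋙ (H ⋙ I') = Y) :
    eqToHom a ≫ Functor.whiskerRight (eqToHom k₁ ≫ Functor.whiskerLeft F (Functor.whiskerRight θ J) ≫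
      eqToHom k₂) I ≫ eqToHom b = eqToHom eX ≫ Functor.whiskerLeft F (Functor.whiskerRight θ I') ≫ eqToHom eY := by
  subst hI k₁ k₂ a b
  ext x
  simp only [NatTrans.comp_app, eqToHom_app, Functor.whiskerRight_app, Functor.whiskerLeft_app,
    Functor.map_comp, eqToHom_map, Functor.comp_map]
  repeat erw [eqToHom_refl]
  repeat erw [Category.id_comp]
  repeat erw [Category.comp_id]

/-- Core vertices are not `𝒩`. [cite: MochizukiAbsTopIII2015, Corollary 3.6 (i) p.78] -/
theorem ne_third_of_coreVertices {d : LFVertex} (hd : coreVertices d) : d ≠ LFVertex.third := by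
  rcases hd with rfl | rfl | rfl <;> decide

variable {Δ} in
/-- **The cross identity for a pair into `𝒩` from «its whiskered 𝔖_log homotopy lies over `ℰ`»**: if
`pushLogη (P, Q) ▷ 𝒟_{𝒩→ℰ}` lies over the structure isomorphisms of `overE` (componentwise: `hθ`), then for every
pre-whisker `r` and post-whisker `r₂` into a core vertex the glued (universal-over-`ℰ`) homotopy of the image pair
is `𝒟_{embLog[r]} ◁ (pushLogη (P,Q) ▷ 𝒟_{r₂})` — by `univFamily_η_eq` at the decomposition through `ℰ` and the
uniqueness of lifts `lift_comp_cons_eq_whisker`. [cite: MochizukiAbsTopIII2015, Corollary 3.6 (iii) p.81] -/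
theorem imageCross_of_over {H₃ : Δ.sub3.HomotopyFamily} (hgen : HomotopyFamily.IsGeneratedBy _ H₃ Δ.LogGen)
    {a₀ : logObsShape.{u}.Vertex} {P Q : Path a₀ lvObs} (hh : H₃.E P Q)
    (hθ : ∀ y : Δ.diagram.obj (embLog.obj a₀),
      (Δ.overE.N LFVertex.fourth).map ((Δ.diagram.map LFVertex.edge34).map ((Δ.pushLogη H₃ hh).app y)) =
        (Δ.overE.μ LFVertex.edge34).hom.app ((Δ.diagram.pathFunctor (embLog.mapPath P)).obj y) ≫
          (Δ.overE.pathIso (embLog.mapPath P)).hom.app y ≫ (Δ.overE.pathIso (embLog.mapPath Q)).inv.app y ≫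
          (Δ.overE.μ LFVertex.edge34).inv.app ((Δ.diagram.pathFunctor (embLog.mapPath Q)).obj y))
    {c₀ : logObsShape.{u}.Vertex} (r : Path c₀ a₀) {d : LFVertex} (r₂ : Path LFVertex.third d)
    (hd : coreVertices d)
    (h' : Δ.GlueE ((embLog.mapPath r).comp ((embLog.mapPath P).comp r₂))
      ((embLog.mapPath r).comp ((embLog.mapPath Q).comp r₂))) :
    Δ.glueη H₃ hgen h' =
      eqToHom (by rw [pathFunctor_comp, pathFunctor_comp]) ≫
        Functor.whiskerLeft (Δ.diagram.pathFunctor (embLog.mapPath r))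
          (Functor.whiskerRight (Δ.pushLogη H₃ hh) (Δ.diagram.pathFunctor r₂)) ≫
        eqToHom (by rw [pathFunctor_comp, pathFunctor_comp]) := by
  obtain ⟨s, rfl⟩ := exists_eq_edge34_comp r₂ (ne_third_of_coreVertices hd)
  rw [Δ.glueη_of_coreVertices H₃ hgen hd h']
  let d₀ : Decomp coreVertices ((embLog.mapPath r).comp ((embLog.mapPath P).comp
      (((Path.nil : Path LFVertex.third LFVertex.third).cons LFVertex.edge34).comp s)))
      ((embLog.mapPath r).comp ((embLog.mapPath Q).comp
      (((Path.nil : Path LFVertex.third LFVertex.third).cons LFVertex.edge34).comp s))) :=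
    ⟨LFVertex.fourth, Or.inl rfl, ((embLog.mapPath r).comp (embLog.mapPath P)).cons LFVertex.edge34,
      ((embLog.mapPath r).comp (embLog.mapPath Q)).cons LFVertex.edge34, s,
      ((Path.comp_assoc _ _ s).trans (congrArg (embLog.mapPath r).comp (Path.comp_assoc _ _ s))).symm,
      ((Path.comp_assoc _ _ s).trans (congrArg (embLog.mapPath r).comp (Path.comp_assoc _ _ s))).symm⟩
  rw [show Δ.coresFamily.η _ = d₀.η Δ.overE coreVertices Δ.coreVertices_fullyFaithful from
    univFamily_η_eq Δ.overE coreVertices Δ.coreVertices_fullyFaithful _ d₀]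
  rw [Decomp.η, Δ.overE.lift_comp_cons_eq_whisker _ (embLog.mapPath r) (embLog.mapPath P) (embLog.mapPath Q)
    LFVertex.edge34 (Δ.pushLogη H₃ hh) hθ (by rw [pathFunctor_cons, pathFunctor_comp]; rfl)
    (by rw [pathFunctor_cons, pathFunctor_comp]; rfl)]
  exact sandwich_whiskerRight_whiskerLeft _ _ _
    (show Δ.diagram.pathFunctor (((Path.nil : Path LFVertex.third LFVertex.third).cons LFVertex.edge34).comp s) =
        Δ.diagram.map LFVertex.edge34 ⋙ Δ.diagram.pathFunctor s by
      rw [pathFunctor_comp, pathFunctor_cons, pathFunctor_nil, Functor.id_comp]) _ _ _ _ _ _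

/-! ### §8 (abc-iut-w5-d053): the generator identity (G) — type (2), holomorphic direction -/

/-- Generic: components of heterogeneously equal natural transformations between propositionally equal
functors. [folklore] -/
private theorem natTrans_app_of_heq {A B : Type*} [Category A] [Category B] {F G F' G' : A ⥤ B} {α : F ⟶ G}
    {β : F' ⟶ G'} (h : HEq α β) (hF : F = F') (hG : G = G') (x : A) :
    β.app x = eqToHom (Functor.congr_obj hF x).symm ≫ α.app x ≫ eqToHom (Functor.congr_obj hG x) := by
  subst hF hG
  have h' := eq_of_heq h
  subst h'
  simp

/-- Generic: an identity `L = α₁ ≫ π₁ ≫ π₂⁻¹ ≫ α₂⁻¹` of isomorphism components from `L ≫ α₂ ≫ π₂ = α₁ ≫ π₁`.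
[folklore] -/
private theorem eq_hom_hom_inv_inv {C : Type*} [Category C] {A₁ B₁ A₂ B₂ K : C} (α₁ : A₁ ≅ B₁) (π₁ : B₁ ≅ K)
    (α₂ : A₂ ≅ B₂) (π₂ : B₂ ≅ K) (L : A₁ ⟶ A₂) (key : L ≫ α₂.hom ≫ π₂.hom = α₁.hom ≫ π₁.hom) :
    L = α₁.hom ≫ π₁.hom ≫ π₂.inv ≫ α₂.inv := by
  have : L = (α₁.hom ≫ π₁.hom) ≫ π₂.inv ≫ α₂.inv := by
    rw [← key]
    simp
  simpa using this

/-- The path functors of `𝒟_{≤3}` are those of `𝒟` on the image paths (heterogeneously; from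
`sub3_eq_comapAlong`). [cite: MochizukiAbsTopIII2015, Corollary 3.6 (iii) p.80] -/
theorem sub3_pathFunctor_heq {a b : logObsShape.{u}.Vertex} (p : Path a b) :
    HEq (Δ.sub3.pathFunctor p) (Δ.diagram.pathFunctor (embLog.mapPath p)) := by
  rw [Δ.sub3_eq_comapAlong, pathFunctor_comapAlong]

/-- The structure isomorphism of `overE` at `𝒩 → ℰ` is the unitor. [cite: MochizukiAbsTopIII2015, Corollary 3.6 (i) p.80] -/
theorem overE_μ_edge34 : Δ.overE.μ LFVertex.edge34 = Δ.NtoE.rightUnitor := rfl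

/-- The structure isomorphism of `overE` at `λ^×`. [cite: MochizukiAbsTopIII2015, Corollary 3.6 (i) p.80] -/
theorem overE_μ_lamTimes :
    Δ.overE.μ (show (LFVertex.nexus ⟶ LFVertex.third) from (⟨true⟩ : ULift Bool)) = eqToIso Δ.lamTimes_NtoE := rfl

/-- The structure isomorphism of `overE` at `λ^{×pf}`. [cite: MochizukiAbsTopIII2015, Corollary 3.6 (i) p.80] -/
theorem overE_μ_lamPf :
    Δ.overE.μ (show (LFVertex.nexus ⟶ LFVertex.third) from (⟨false⟩ : ULift Bool)) = eqToIso Δ.lamPf_NtoE := rfl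

variable {Δ} in
/-- **(G), type (2), holomorphic direction (`ι_× : λ^× → λ^{×pf}`)**: the whiskered `𝔖_log` homotopy of the
basic type-(2) pair lies over `ℰ` — componentwise `(𝒩→ℰ)(ι_×) = ` the structure isomorphisms — by `LogPinned`
(the homotopy IS `ι_×`) and `IotaOverGaloisStmt` (`ι_×` maps to the identity of `ℰ`).
[cite: MochizukiAbsTopIII2015, Corollary 3.6 (iii) p.81] -/
theorem over_timesPair_inl {H₃ : Δ.sub3.HomotopyFamily} (hH₃ : Δ.IsLogObservableFamily H₃)
    (hι : Δ.IotaOverGaloisStmt) {ι : Δ.lamTimes ⟶ Δ.lamPf} (hΔ : Δ.ιtimes = Sum.inl ι)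
    (hh : H₃.E ((Path.nil : Path lvNexus.{u} lvNexus).cons eLamTimes)
      ((Path.nil : Path lvNexus.{u} lvNexus).cons eLamPf))
    (y : Δ.diagram.obj (embLog.obj lvNexus.{u})) :
    (Δ.overE.N LFVertex.fourth).map ((Δ.diagram.map LFVertex.edge34).map ((Δ.pushLogη H₃ hh).app y)) =
      (Δ.overE.μ LFVertex.edge34).hom.app
          ((Δ.diagram.pathFunctor (embLog.mapPath ((Path.nil : Path lvNexus.{u} lvNexus).cons eLamTimes))).obj y) ≫
        (Δ.overE.pathIso (embLog.mapPath ((Path.nil : Path lvNexus.{u} lvNexus).cons eLamTimes))).hom.app y ≫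
        (Δ.overE.pathIso (embLog.mapPath ((Path.nil : Path lvNexus.{u} lvNexus).cons eLamPf))).inv.app y ≫
        (Δ.overE.μ LFVertex.edge34).inv.app
          ((Δ.diagram.pathFunctor (embLog.mapPath ((Path.nil : Path lvNexus.{u} lvNexus).cons eLamPf))).obj y) := by
  -- the pinned component of the `𝔖_log` homotopy
  have hpin := hH₃.2.2.1
  rw [hΔ] at hpin
  obtain ⟨h₀, hpin⟩ := hpin
  have hιx := hι.1
  rw [hΔ] at hιx
  have hcomp := natTrans_app_of_heq (Δ.heq_pushLogη H₃ hh) (eq_of_heq (Δ.sub3_pathFunctor_heq _))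
    (eq_of_heq (Δ.sub3_pathFunctor_heq _)) y
  have e₁ : (Δ.sub3.pathFunctor ((Path.nil : Path lvNexus.{u} lvNexus).cons eLamTimes)).obj y =
      Δ.lamTimes.obj y :=
    (Functor.congr_obj (eq_of_heq (Δ.sub3_pathFunctor_heq _)) y).trans
      (by rw [Prefunctor.mapPath_cons, Prefunctor.mapPath_nil, pathFunctor_cons, pathFunctor_nil]; rfl)
  have e₂ : (Δ.sub3.pathFunctor ((Path.nil : Path lvNexus.{u} lvNexus).cons eLamPf)).obj y =
      Δ.lamPf.obj y :=
    (Functor.congr_obj (eq_of_heq (Δ.sub3_pathFunctor_heq _)) y).trans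
      (by rw [Prefunctor.mapPath_cons, Prefunctor.mapPath_nil, pathFunctor_cons, pathFunctor_nil]; rfl)
  rw [hpin y e₁ e₂] at hcomp
  refine eq_hom_hom_inv_inv ((Δ.overE.μ LFVertex.edge34).app _) ((Δ.overE.pathIso _).app y)
    ((Δ.overE.μ LFVertex.edge34).app _) ((Δ.overE.pathIso _).app y) _ ?_
  show Δ.NtoE.map ((Δ.pushLogη H₃ hh).app y) ≫ _ = _
  rw [hcomp]
  dsimp only at hιx
  simp only [Iso.app_hom, overE_μ_edge34, Functor.rightUnitor_hom_app]
  repeat erw [Functor.map_comp]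
  repeat erw [eqToHom_map]
  erw [hιx y]
  repeat erw [OverData.pathIso_cons_app]
  repeat erw [OverData.pathIso_nil_app]
  erw [overE_μ_lamTimes, overE_μ_lamPf]
  simp only [eqToIso.hom, eqToHom_app]
  repeat erw [Category.id_comp]
  repeat erw [eqToHom_trans]
  rfl

/-! ### §9 (abc-iut-w5-d053): the generator identity (G) — type (1) -/

/-- Generic: `eqToHom`-conjugates of heterogeneously equal morphisms with the same outer endpoints agree.
[folklore] -/
private theorem eqToHom_conj_congr {C : Type*} [Category C] {A B X Y X' Y' : C} {M : X ⟶ Y} {M' : X' ⟶ Y'}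
    (h : HEq M M') (a : A = X) (b : Y = B) (a' : A = X') (b' : Y' = B) :
    eqToHom a ≫ M ≫ eqToHom b = eqToHom a' ≫ M' ≫ eqToHom b' := by
  subst a b a'
  have hY : Y' = Y := b'
  subst hY
  have hM := eq_of_heq h
  subst hM
  rfl

/-- The structure isomorphism of `overE` at `log` (row `⋎+1 → ⋎`): `log ≅ 𝟭` whiskered into `ℰ`.
[cite: MochizukiAbsTopIII2015, Corollary 3.6 (i) p.80] -/
theorem overE_μ_logEdge (n : ℤ) :
    Δ.overE.μ (LFVertex.logEdge n) =
      Functor.isoWhiskerRight Δ.logIsoId (Δ.toNexus ⋙ Δ.XtoE) ≪≫ (Δ.toNexus ⋙ Δ.XtoE).leftUnitor := rfl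

/-- The structure isomorphism of `overE` at `id_⋎` is the identity. [cite: MochizukiAbsTopIII2015, Corollary 3.6 (i) p.80] -/
theorem overE_μ_idEdge (n : ℤ) : Δ.overE.μ (LFVertex.idEdge n) = Iso.refl _ := rfl

variable {Δ} in
/-- **(G), type (1) (`ι_{log,⋎} : λ^× ∘ id_⋎ ∘ log → λ^{×pf} ∘ id_{⋎+1}`)**: the whiskered `𝔖_log` homotopy of
the basic type-(1) pair lies over `ℰ` — componentwise `(𝒩→ℰ)(ι_{log})` is the structure isomorphism built from
`log ≅ 𝟭` — by `LogPinned` (the homotopy IS `ι_{log,⋎}`) and `IotaOverGaloisStmt` (second clause).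
[cite: MochizukiAbsTopIII2015, Corollary 3.6 (iii) p.81] -/
theorem over_logPair {H₃ : Δ.sub3.HomotopyFamily} (hH₃ : Δ.IsLogObservableFamily H₃)
    (hι : Δ.IotaOverGaloisStmt) (n : ℤ) (hh : H₃.E (logPairLeft.{u} n) (logPairRight.{u} n))
    (y : Δ.diagram.obj (embLog.obj (lvRow1.{u} (n + 1)))) :
    (Δ.overE.N LFVertex.fourth).map ((Δ.diagram.map LFVertex.edge34).map ((Δ.pushLogη H₃ hh).app y)) =
      (Δ.overE.μ LFVertex.edge34).hom.app
          ((Δ.diagram.pathFunctor (embLog.mapPath (logPairLeft.{u} n))).obj y) ≫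
        (Δ.overE.pathIso (embLog.mapPath (logPairLeft.{u} n))).hom.app y ≫
        (Δ.overE.pathIso (embLog.mapPath (logPairRight.{u} n))).inv.app y ≫
        (Δ.overE.μ LFVertex.edge34).inv.app
          ((Δ.diagram.pathFunctor (embLog.mapPath (logPairRight.{u} n))).obj y) := by
  obtain ⟨h₀, hpin⟩ := hH₃.2.2.2 n
  have hιx := hι.2
  have hcomp := natTrans_app_of_heq (Δ.heq_pushLogη H₃ hh) (eq_of_heq (Δ.sub3_pathFunctor_heq _))
    (eq_of_heq (Δ.sub3_pathFunctor_heq _)) y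
  have e₁ : (Δ.sub3.pathFunctor (logPairLeft.{u} n)).obj y = Δ.lamTimes.obj (Δ.toNexus.obj (Δ.log.obj y)) :=
    (Functor.congr_obj (eq_of_heq (Δ.sub3_pathFunctor_heq _)) y).trans
      (by
        erw [pathFunctor_cons, pathFunctor_cons, pathFunctor_cons, pathFunctor_nil]
        rfl)
  have e₂ : (Δ.sub3.pathFunctor (logPairRight.{u} n)).obj y = Δ.lamPf.obj (Δ.toNexus.obj y) :=
    (Functor.congr_obj (eq_of_heq (Δ.sub3_pathFunctor_heq _)) y).trans
      (by
        erw [pathFunctor_cons, pathFunctor_cons, pathFunctor_nil]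
        rfl)
  rw [hpin y e₁ e₂] at hcomp
  refine eq_hom_hom_inv_inv ((Δ.overE.μ LFVertex.edge34).app _) ((Δ.overE.pathIso _).app y)
    ((Δ.overE.μ LFVertex.edge34).app _) ((Δ.overE.pathIso _).app y) _ ?_
  show Δ.NtoE.map ((Δ.pushLogη H₃ hh).app y) ≫ _ = _
  rw [hcomp]
  simp only [Iso.app_hom, overE_μ_edge34, Functor.rightUnitor_hom_app]
  repeat erw [Functor.map_comp]
  repeat erw [eqToHom_map]
  erw [hιx y]
  repeat erw [OverData.pathIso_cons_app]
  repeat erw [OverData.pathIso_nil_app]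
  erw [overE_μ_lamTimes, overE_μ_lamPf, overE_μ_logEdge, overE_μ_idEdge]
  simp only [eqToIso.hom, eqToHom_app, Iso.refl_hom, NatTrans.id_app, Iso.trans_hom,
    Functor.isoWhiskerRight_hom, Functor.leftUnitor_hom_app, NatTrans.comp_app, Functor.whiskerRight_app,
    Functor.comp_map]
  repeat erw [Category.assoc]
  repeat erw [Category.id_comp]
  repeat erw [eqToHom_trans_assoc]
  repeat erw [eqToHom_trans]
  have hy : (Δ.diagram.pathFunctor (embLog.mapPath
      (Path.nil : Path (lvRow1.{u} (n + 1)) (lvRow1.{u} (n + 1))))).obj y = y := by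
    erw [pathFunctor_nil]
    rfl
  refine eqToHom_conj_congr ?_ _ _ _ _
  rw [hy]
  exact HEq.rfl

/-! ### §10 (abc-iut-w5-d053): type (2), anti-holomorphic direction, and the generator identity assembled -/

variable {Δ} in
/-- **(G), type (2), direction `ι_× : λ^{×pf} → λ^×`** (the `.inr` flag; mirror image of `over_timesPair_inl`).
[cite: MochizukiAbsTopIII2015, Corollary 3.6 (iii) p.81] -/
theorem over_timesPair_inr {H₃ : Δ.sub3.HomotopyFamily} (hH₃ : Δ.IsLogObservableFamily H₃)
    (hι : Δ.IotaOverGaloisStmt) {ι : Δ.lamPf ⟶ Δ.lamTimes} (hΔ : Δ.ιtimes = Sum.inr ι)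
    (hh : H₃.E ((Path.nil : Path lvNexus.{u} lvNexus).cons eLamPf)
      ((Path.nil : Path lvNexus.{u} lvNexus).cons eLamTimes))
    (y : Δ.diagram.obj (embLog.obj lvNexus.{u})) :
    (Δ.overE.N LFVertex.fourth).map ((Δ.diagram.map LFVertex.edge34).map ((Δ.pushLogη H₃ hh).app y)) =
      (Δ.overE.μ LFVertex.edge34).hom.app
          ((Δ.diagram.pathFunctor (embLog.mapPath ((Path.nil : Path lvNexus.{u} lvNexus).cons eLamPf))).obj y) ≫
        (Δ.overE.pathIso (embLog.mapPath ((Path.nil : Path lvNexus.{u} lvNexus).cons eLamPf))).hom.app y ≫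
        (Δ.overE.pathIso (embLog.mapPath ((Path.nil : Path lvNexus.{u} lvNexus).cons eLamTimes))).inv.app y ≫
        (Δ.overE.μ LFVertex.edge34).inv.app
          ((Δ.diagram.pathFunctor (embLog.mapPath ((Path.nil : Path lvNexus.{u} lvNexus).cons eLamTimes))).obj y) := by
  have hpin := hH₃.2.2.1
  rw [hΔ] at hpin
  obtain ⟨h₀, hpin⟩ := hpin
  have hιx := hι.1
  rw [hΔ] at hιx
  have hcomp := natTrans_app_of_heq (Δ.heq_pushLogη H₃ hh) (eq_of_heq (Δ.sub3_pathFunctor_heq _))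
    (eq_of_heq (Δ.sub3_pathFunctor_heq _)) y
  have e₁ : (Δ.sub3.pathFunctor ((Path.nil : Path lvNexus.{u} lvNexus).cons eLamPf)).obj y =
      Δ.lamPf.obj y :=
    (Functor.congr_obj (eq_of_heq (Δ.sub3_pathFunctor_heq _)) y).trans
      (by rw [Prefunctor.mapPath_cons, Prefunctor.mapPath_nil, pathFunctor_cons, pathFunctor_nil]; rfl)
  have e₂ : (Δ.sub3.pathFunctor ((Path.nil : Path lvNexus.{u} lvNexus).cons eLamTimes)).obj y =
      Δ.lamTimes.obj y :=
    (Functor.congr_obj (eq_of_heq (Δ.sub3_pathFunctor_heq _)) y).trans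
      (by rw [Prefunctor.mapPath_cons, Prefunctor.mapPath_nil, pathFunctor_cons, pathFunctor_nil]; rfl)
  rw [hpin y e₁ e₂] at hcomp
  refine eq_hom_hom_inv_inv ((Δ.overE.μ LFVertex.edge34).app _) ((Δ.overE.pathIso _).app y)
    ((Δ.overE.μ LFVertex.edge34).app _) ((Δ.overE.pathIso _).app y) _ ?_
  show Δ.NtoE.map ((Δ.pushLogη H₃ hh).app y) ≫ _ = _
  rw [hcomp]
  dsimp only at hιx
  simp only [Iso.app_hom, overE_μ_edge34, Functor.rightUnitor_hom_app]
  repeat erw [Functor.map_comp]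
  repeat erw [eqToHom_map]
  erw [hιx y]
  repeat erw [OverData.pathIso_cons_app]
  repeat erw [OverData.pathIso_nil_app]
  erw [overE_μ_lamTimes, overE_μ_lamPf]
  simp only [eqToIso.hom, eqToHom_app]
  repeat erw [Category.id_comp]
  repeat erw [eqToHom_trans]
  rfl

/-- `timesPairLeft` in the holomorphic direction. [cite: MochizukiAbsTopIII2015, Corollary 3.6 (iii) p.81] -/
theorem timesPairLeft_of_inl {ι : Δ.lamTimes ⟶ Δ.lamPf} (hΔ : Δ.ιtimes = Sum.inl ι) :
    Δ.timesPairLeft = (Path.nil : Path lvNexus.{u} lvNexus).cons eLamTimes := by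
  unfold timesPairLeft; rw [hΔ]

/-- `timesPairRight` in the holomorphic direction. [cite: MochizukiAbsTopIII2015, Corollary 3.6 (iii) p.81] -/
theorem timesPairRight_of_inl {ι : Δ.lamTimes ⟶ Δ.lamPf} (hΔ : Δ.ιtimes = Sum.inl ι) :
    Δ.timesPairRight = (Path.nil : Path lvNexus.{u} lvNexus).cons eLamPf := by
  unfold timesPairRight; rw [hΔ]

/-- `timesPairLeft` in the anti-holomorphic direction. [cite: MochizukiAbsTopIII2015, Corollary 4.5 (iii) p.105] -/
theorem timesPairLeft_of_inr {ι : Δ.lamPf ⟶ Δ.lamTimes} (hΔ : Δ.ιtimes = Sum.inr ι) :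
    Δ.timesPairLeft = (Path.nil : Path lvNexus.{u} lvNexus).cons eLamPf := by
  unfold timesPairLeft; rw [hΔ]

/-- `timesPairRight` in the anti-holomorphic direction. [cite: MochizukiAbsTopIII2015, Corollary 4.5 (iii) p.105] -/
theorem timesPairRight_of_inr {ι : Δ.lamPf ⟶ Δ.lamTimes} (hΔ : Δ.ιtimes = Sum.inr ι) :
    Δ.timesPairRight = (Path.nil : Path lvNexus.{u} lvNexus).cons eLamTimes := by
  unfold timesPairRight; rw [hΔ]

variable {Δ} in
/-- **The GENERATOR IDENTITY (G) of «Cor36-CROSS» from `IotaOverGaloisStmt`.**  For every generator pair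
`(p, q) ∈ LogGen` (types (1)/(2) of Cor. 3.6 (iii)), every pre-whisker `r` and every post-whisker `r₂` into a
core vertex, the glued (universal-over-`ℰ`) homotopy of the image pair is `𝒟_{embLog[r]} ◁ (pushLogη (p,q) ▷
𝒟_{r₂})` — GIVEN `IotaOverGaloisStmt` (F-0360: `ι_×`, `ι_{log}` lie over `ℰ`; PROVED AT THE MODEL) and a
log-observable family `H₃` (`LogPinned`: its homotopies on the basic pairs ARE `ι_×`, `ι_{log,⋎}`).  Conclusion =
LITERALLY the `hbase` binder of `imageCross_of_generators`. [cite: MochizukiAbsTopIII2015, Corollary 3.6 (iii) p.81] -/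
theorem generatorCross_of_iotaOverGalois {H₃ : Δ.sub3.HomotopyFamily} (hH₃ : Δ.IsLogObservableFamily H₃)
    (hι : Δ.IotaOverGaloisStmt)
    ⦃c₀ a₀ b₀ : logObsShape.{u}.Vertex⦄ (r : Path c₀ a₀) (p q : Path a₀ b₀) (hg : Δ.LogGen p q)
    ⦃d : LFVertex⦄ (r₂ : Path (embLog.obj b₀) d) (hd : coreVertices d)
    (h' : Δ.GlueE ((embLog.mapPath r).comp ((embLog.mapPath p).comp r₂))
      ((embLog.mapPath r).comp ((embLog.mapPath q).comp r₂))) :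
    Δ.glueη H₃ hH₃.1 h' =
      eqToHom (by rw [pathFunctor_comp, pathFunctor_comp]) ≫
        Functor.whiskerLeft (Δ.diagram.pathFunctor (embLog.mapPath r))
          (Functor.whiskerRight (Δ.pushLogη H₃ ((hH₃.1 p q).mpr (Saturation.base hg)))
            (Δ.diagram.pathFunctor r₂)) ≫
        eqToHom (by rw [pathFunctor_comp, pathFunctor_comp]) := by
  cases hg with
  | type1 n => exact imageCross_of_over hH₃.1 _ (over_logPair hH₃ hι n _) r r₂ hd h'
  | type2 =>
    have key : ∀ (P Q : Path lvNexus.{u} lvObs) (hh : H₃.E P Q)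
        (hP : P = Δ.timesPairLeft) (hQ : Q = Δ.timesPairRight)
        (h'' : Δ.GlueE ((embLog.mapPath r).comp ((embLog.mapPath P).comp r₂))
          ((embLog.mapPath r).comp ((embLog.mapPath Q).comp r₂))),
        Δ.glueη H₃ hH₃.1 h'' =
          eqToHom (by rw [pathFunctor_comp, pathFunctor_comp]) ≫
            Functor.whiskerLeft (Δ.diagram.pathFunctor (embLog.mapPath r))
              (Functor.whiskerRight (Δ.pushLogη H₃ hh) (Δ.diagram.pathFunctor r₂)) ≫
            eqToHom (by rw [pathFunctor_comp, pathFunctor_comp]) := by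
      intro P Q hh hP hQ h''
      rcases hΔ : Δ.ιtimes with ι | ι
      · have hP' := hP.trans (Δ.timesPairLeft_of_inl hΔ)
        have hQ' := hQ.trans (Δ.timesPairRight_of_inl hΔ)
        subst hP' hQ'
        exact imageCross_of_over hH₃.1 hh (over_timesPair_inl hH₃ hι hΔ hh) r r₂ hd h''
      · have hP' := hP.trans (Δ.timesPairLeft_of_inr hΔ)
        have hQ' := hQ.trans (Δ.timesPairRight_of_inr hΔ)
        subst hP' hQ'
        exact imageCross_of_over hH₃.1 hh (over_timesPair_inr hH₃ hι hΔ hh) r r₂ hd h''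
    exact key _ _ _ rfl rfl h'

end LogFrobeniusData

end Literature.AnabelianGeometry.AbsoluteAnabelian
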